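import Literature.Probability.RandomPlanarGeometry.SAWLowerBound
import Literature.Probability.RandomPlanarGeometry.SAWFiniteMemory16
import HarnessLib

/-!
# Discharge of `LawlerSchrammWerner2004SAW_connectiveConstant_bounds`: `2.6 ≤ μ(ℤ²) ≤ 2.7`

Topic `Literature/Probability/RandomPlanarGeometry`; certificate file for the named fact of
`SelfAvoidingWalk.lean` (Lawler–Schramm–Werner 2004, §3.1: the connective constant of `ℤ²`
"rigorously … is known to be between 2.6 and 2.7"). Both halves are computer-assisted results in
print and are discharged here by kernel-checked certificates:

* `μ ≤ 2.7`: `connectiveConstant_le_27` (`SAWFiniteMemory16.lean`) — the memory-16 automaton of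
  Pönitz–Tittmann (2000) with a verified Collatz–Wielandt certificate, `μ ≤ 2.695`
  (one `native_decide`, 467 249 states);
* `2.6 ≤ μ`: `le_connectiveConstant_26` (`SAWLowerBound.lean`) — Kesten's irreducible-bridge
  renewal bound (Jensen 2004, §2) with the span-1 family and a formally verified strip transfer
  matrix for spans 2–6 (`SAWStripTM*.lean`; five `native_decide` evaluations), Kraft sum
  `1.0015 ≥ 1` at fugacity `1/2.6`.

Trust base: the Lean kernel plus `Lean.ofReduceBool` (the compiler, for the six compiled
evaluations). Total compute < 10 core-minutes.

## References

* G. F. Lawler, O. Schramm, W. Werner, *On the scaling limit of planar self-avoiding walk*,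
  Proc. Sympos. Pure Math. 72 (2004), §3.1.
* A. Pönitz, P. Tittmann, Electron. J. Combin. 7 (2000) R21.
* I. Jensen, J. Phys. A 37 (2004) 11521–11529.
-/

namespace Literature.Probability.RandomPlanarGeometry.SAW

/-- **Discharge** of the quoted bounds `2.6 ≤ μ(ℤ²) ≤ 2.7`. Computational grade: rests on the
`native_decide` evaluations `StripTM.dp_two`–`StripTM.dp_six` (lower half) and
`FiniteMemory.check_16` (upper half), i.e. on `Lean.ofReduceBool`, and on nothing else beyond the
standard axioms. [cite: LawlerSchrammWerner2004SAW, §3.1] -/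
theorem LawlerSchrammWerner2004SAW_connectiveConstant_bounds_holds :
    LawlerSchrammWerner2004SAW_connectiveConstant_bounds :=
  ⟨le_connectiveConstant_26, connectiveConstant_le_27⟩

end Literature.Probability.RandomPlanarGeometry.SAW
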